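import Mathlib
import Summits.ValiantsHypothesis.ValiantsHypothesis.Theorems.LangWeilTransferGoodReductionFactorCount
import Literature.RingTheory.MvPolynomial.GeomComponentCount

/-!
# LangWeilTransfer, crux `TameTransfer` (stmt-ValiantsHypothesis-6373) — the hypersurface model:
# its kernel and, for one geometric component, its absolute irreducibility

Route `LangWeilTransfer` of `ValiantsHypothesis`. Theorem T (`TameTransfer`) is reduced BY NAME to
the support `TameResolution` (stmt-6378; `tameTransfer_of_goodReduction_of_tameResolution`,
`goodReduction_proof`). A geometric resolution of a prime `𝔭 ⊆ k[Y]` produces Noether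
coordinates `ℓ₁, …, ℓ_r` (algebraically independent modulo `𝔭`), an element `u`, and a polynomial
`Q ∈ k[U, T₁, …, T_r]`, monic (up to a unit) and irreducible, with `Q(u, ℓ) ∈ 𝔭`. This file
supplies two algebraic facts about that situation, independent of how `Q` was constructed:

* `comap_aeval_cons_eq_span_singleton` — **the kernel of the substitution
  `k[U, T] → k[Y]/𝔭`, `U ↦ u`, `T ↦ ℓ`, is exactly `(Q)`**: `Q` (made monic) is the minimal
  polynomial of `ū` over the integrally closed domain `k[T] ↪ k[Y]/𝔭`, which divides every
  polynomial vanishing at `ū` (`minpoly.isIntegrallyClosed_dvd`); variant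
  `comap_aeval_cons_eq_span_singleton_of_leadingCoeff_eq_C` for a constant unit leading
  coefficient (the shape `(finSuccEquiv ℤ r Q).leadingCoeff = C cQ` of `TameResolution`, read over
  `ℚ`).
* `prime_map_of_geomComponentCount_le_one` — **over a perfect field, an irreducible `Q` whose
  hypersurface has at most one geometric component is absolutely irreducible** (`Q` is squarefree
  over `k̄`, `squarefree_map_of_irreducible`, and the radical of `(Q)k̄[X]` is prime,
  `geomComponentCount_eq_one_iff`; a squarefree element generating an ideal with prime radical is
  prime). This is the case `B = 1` (one geometric component) of the component count.

With the Literature theorem `geomComponentCount_comap_le` (dominant maps do not increase the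
geometric number of components) these give step (C) of the resolution:
`#geometric factors of Q ≤ #geometric components of V(𝔭)`, and `= 1 ⇒ Q` absolutely irreducible.
Honest framing: helper lemmas `--supports` an open crux of a conditional route; VP ≠ VNP is NOT
proved and nothing here bears on it.
-/

noncomputable section

open MvPolynomial Polynomial

-- the summit and the problem share the name `ValiantsHypothesis` (D-0017 single-conjunct layout)
set_option linter.dupNamespace false

namespace Summit.ValiantsHypothesis.ValiantsHypothesis.Theorems.LangWeilTransfer

open Literature.RingTheory.MvPolynomial

/-! ## The kernel of the substitution is `(Q)` -/

section Kernel

variable {k : Type*} [Field k] {τ : Type*} {r : ℕ}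

/-- Compatibility of the two evaluations: for `f ∈ k[X₀, X₁, …, X_r]`, evaluating
`finSuccEquiv f ∈ k[X₁..X_r][X]` at `ū` over the `k[X₁..X_r]`-algebra `k[Y]/P` (structure map
`Xᵢ ↦ ℓᵢ mod P`) gives `f(u, ℓ) mod P`. -/
theorem aeval_finSuccEquiv_eq_mk_aeval_cons (P : Ideal (MvPolynomial τ k))
    (ℓ : Fin r → MvPolynomial τ k) (u : MvPolynomial τ k) (f : MvPolynomial (Fin (r + 1)) k) :
    letI : Algebra (MvPolynomial (Fin r) k) (MvPolynomial τ k ⧸ P) :=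
      ((MvPolynomial.aeval fun i => Ideal.Quotient.mk P (ℓ i)) :
        MvPolynomial (Fin r) k →ₐ[k] MvPolynomial τ k ⧸ P).toRingHom.toAlgebra
    Polynomial.aeval (Ideal.Quotient.mk P u) (finSuccEquiv k r f) =
      Ideal.Quotient.mk P (MvPolynomial.aeval (Fin.cons u ℓ : Fin (r + 1) → MvPolynomial τ k) f) := by
  letI : Algebra (MvPolynomial (Fin r) k) (MvPolynomial τ k ⧸ P) :=
    ((MvPolynomial.aeval fun i => Ideal.Quotient.mk P (ℓ i)) :
      MvPolynomial (Fin r) k →ₐ[k] MvPolynomial τ k ⧸ P).toRingHom.toAlgebra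
  have hsc : IsScalarTower k (MvPolynomial (Fin r) k) (MvPolynomial τ k ⧸ P) :=
    IsScalarTower.of_algebraMap_eq fun c => by
      rw [RingHom.algebraMap_toAlgebra, AlgHom.toRingHom_eq_coe, AlgHom.coe_toRingHom,
        AlgHom.commutes]
  -- both sides are `k`-algebra maps out of `k[X₀..X_r]`; compare them on the variables
  set L : MvPolynomial (Fin (r + 1)) k →ₐ[k] MvPolynomial τ k ⧸ P :=
    ((Polynomial.aeval (Ideal.Quotient.mk P u) :
        (MvPolynomial (Fin r) k)[X] →ₐ[MvPolynomial (Fin r) k] MvPolynomial τ k ⧸ P).restrictScalars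
        k).comp (finSuccEquiv k r).toAlgHom with hL
  set R : MvPolynomial (Fin (r + 1)) k →ₐ[k] MvPolynomial τ k ⧸ P :=
    (Ideal.Quotient.mkₐ k P).comp
      (MvPolynomial.aeval (Fin.cons u ℓ : Fin (r + 1) → MvPolynomial τ k)) with hR
  have hLR : L = R := by
    refine MvPolynomial.algHom_ext fun i => ?_
    refine Fin.cases ?_ (fun j => ?_) i
    · simp only [hL, hR, AlgHom.comp_apply, AlgHom.coe_restrictScalars', AlgEquiv.coe_toAlgHom,
        finSuccEquiv_X_zero, Polynomial.aeval_X, Ideal.Quotient.mkₐ_eq_mk,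
        MvPolynomial.aeval_X, Fin.cons_zero]
    · simp only [hL, hR, AlgHom.comp_apply, AlgHom.coe_restrictScalars', AlgEquiv.coe_toAlgHom,
        finSuccEquiv_X_succ, Polynomial.aeval_C, Ideal.Quotient.mkₐ_eq_mk,
        MvPolynomial.aeval_X, Fin.cons_succ, RingHom.algebraMap_toAlgebra, AlgHom.toRingHom_eq_coe,
        AlgHom.coe_toRingHom]
  have := congrArg (fun φ : MvPolynomial (Fin (r + 1)) k →ₐ[k] MvPolynomial τ k ⧸ P => φ f) hLR
  simpa [hL, hR] using this

/-- **The kernel of the model substitution is `(Q)`.** Let `P ⊆ k[Y]` be a prime, `ℓ₁, …, ℓ_r`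
polynomials whose classes are algebraically independent over `k` in `k[Y]/P`, `u ∈ k[Y]`, and
`Q ∈ k[X₀, …, X_r]` irreducible, monic in `X₀` (i.e. `finSuccEquiv Q` monic), with
`Q(u, ℓ) ∈ P`. Then the preimage of `P` under `X₀ ↦ u, Xᵢ ↦ ℓᵢ` is the principal ideal `(Q)`:
`Q` is the minimal polynomial of `ū` over the integrally closed domain `k[X₁..X_r] ↪ k[Y]/P`
(`minpoly.isIntegrallyClosed_dvd`, irreducibility and monicity), which divides every polynomial
vanishing at `ū`. -/
theorem comap_aeval_cons_eq_span_singleton (P : Ideal (MvPolynomial τ k)) [P.IsPrime]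
    (ℓ : Fin r → MvPolynomial τ k) (u : MvPolynomial τ k)
    (hind : AlgebraicIndependent k fun i => Ideal.Quotient.mk P (ℓ i))
    (Q : MvPolynomial (Fin (r + 1)) k) (hmonic : (finSuccEquiv k r Q).Monic) (hirr : Irreducible Q)
    (hroot : MvPolynomial.aeval (Fin.cons u ℓ : Fin (r + 1) → MvPolynomial τ k) Q ∈ P) :
    P.comap (MvPolynomial.aeval (Fin.cons u ℓ : Fin (r + 1) → MvPolynomial τ k)) =
      Ideal.span {Q} := by
  classical
  -- `B = k[Y]/P` as an algebra over `A = k[X₁..X_r]` through `ℓ`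
  letI inst : Algebra (MvPolynomial (Fin r) k) (MvPolynomial τ k ⧸ P) :=
    ((MvPolynomial.aeval fun i => Ideal.Quotient.mk P (ℓ i)) :
      MvPolynomial (Fin r) k →ₐ[k] MvPolynomial τ k ⧸ P).toRingHom.toAlgebra
  letI instM : Module (MvPolynomial (Fin r) k) (MvPolynomial τ k ⧸ P) := Algebra.toModule
  haveI : IsDomain (MvPolynomial τ k ⧸ P) := (Ideal.Quotient.isDomain_iff_prime P).mpr inferInstance
  have hφ : Function.Injective (algebraMap (MvPolynomial (Fin r) k) (MvPolynomial τ k ⧸ P)) := by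
    rw [RingHom.algebraMap_toAlgebra]
    exact (algebraicIndependent_iff_injective_aeval.mp hind)
  haveI : Module.IsTorsionFree (MvPolynomial (Fin r) k) (MvPolynomial τ k ⧸ P) :=
    Module.isTorsionFree_iff_algebraMap_injective.mpr hφ
  have hcompat := aeval_finSuccEquiv_eq_mk_aeval_cons P ℓ u
  -- `ū` is integral with minimal polynomial `finSuccEquiv Q`
  have hQ'root : Polynomial.aeval (Ideal.Quotient.mk P u) (finSuccEquiv k r Q) = 0 := by
    rw [hcompat Q, Ideal.Quotient.eq_zero_iff_mem]
    exact hroot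
  have hint : IsIntegral (MvPolynomial (Fin r) k) (Ideal.Quotient.mk P u) := ⟨_, hmonic, hQ'root⟩
  have hQ'irr : Irreducible (finSuccEquiv k r Q) := (MulEquiv.irreducible_iff (finSuccEquiv k r)).mpr hirr
  have hmin : minpoly (MvPolynomial (Fin r) k) (Ideal.Quotient.mk P u) = finSuccEquiv k r Q := by
    have hdvd : minpoly (MvPolynomial (Fin r) k) (Ideal.Quotient.mk P u) ∣ finSuccEquiv k r Q :=
      minpoly.isIntegrallyClosed_dvd hint hQ'root
    exact Polynomial.eq_of_monic_of_associated (minpoly.monic hint) hmonic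
      ((minpoly.irreducible hint).associated_of_dvd hQ'irr hdvd)
  -- the two inclusions
  apply le_antisymm
  · intro f hf
    rw [Ideal.mem_comap] at hf
    have hf' : Polynomial.aeval (Ideal.Quotient.mk P u) (finSuccEquiv k r f) = 0 := by
      rw [hcompat f, Ideal.Quotient.eq_zero_iff_mem]
      exact hf
    have hdvd : finSuccEquiv k r Q ∣ finSuccEquiv k r f := by
      rw [← hmin]
      exact minpoly.isIntegrallyClosed_dvd hint hf'
    rw [Ideal.mem_span_singleton]
    have := map_dvd (finSuccEquiv k r).symm hdvd
    simpa using this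
  · rw [Ideal.span_singleton_le_iff_mem, Ideal.mem_comap]
    exact hroot

/-- The same with a constant unit leading coefficient instead of monicity:
if `(finSuccEquiv Q).leadingCoeff = C c` with `c ≠ 0` (the shape of `TameResolution`'s `Q` read
over `ℚ`), the kernel of `X₀ ↦ u, Xᵢ ↦ ℓᵢ` modulo `P` is `(Q)`. -/
theorem comap_aeval_cons_eq_span_singleton_of_leadingCoeff_eq_C (P : Ideal (MvPolynomial τ k))
    [P.IsPrime] (ℓ : Fin r → MvPolynomial τ k) (u : MvPolynomial τ k)
    (hind : AlgebraicIndependent k fun i => Ideal.Quotient.mk P (ℓ i))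
    (Q : MvPolynomial (Fin (r + 1)) k) {c : k} (hc : c ≠ 0)
    (hlc : (finSuccEquiv k r Q).leadingCoeff = MvPolynomial.C c) (hirr : Irreducible Q)
    (hroot : MvPolynomial.aeval (Fin.cons u ℓ : Fin (r + 1) → MvPolynomial τ k) Q ∈ P) :
    P.comap (MvPolynomial.aeval (Fin.cons u ℓ : Fin (r + 1) → MvPolynomial τ k)) =
      Ideal.span {Q} := by
  classical
  -- normalise: `Q₁ = c⁻¹ Q` is monic in `X₀`, irreducible, with the same span and root
  set Q₁ : MvPolynomial (Fin (r + 1)) k := MvPolynomial.C c⁻¹ * Q with hQ₁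
  have hunit : IsUnit (MvPolynomial.C c⁻¹ : MvPolynomial (Fin (r + 1)) k) :=
    (isUnit_iff_ne_zero.mpr (inv_ne_zero hc)).map MvPolynomial.C
  have hspan : Ideal.span {Q₁} = Ideal.span {Q} := by
    rw [hQ₁, Ideal.span_singleton_mul_left_unit hunit]
  have hmonic : (finSuccEquiv k r Q₁).Monic := by
    rw [hQ₁, map_mul, finSuccEquiv_apply, eval₂Hom_C, RingHom.comp_apply]
    change (Polynomial.C (MvPolynomial.C c⁻¹) * (finSuccEquiv k r) Q).Monic
    rw [Polynomial.Monic, Polynomial.leadingCoeff_mul', Polynomial.leadingCoeff_C, hlc, ← map_mul,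
      inv_mul_cancel₀ hc, MvPolynomial.C_1]
    rw [Polynomial.leadingCoeff_C, hlc, ← map_mul, inv_mul_cancel₀ hc, MvPolynomial.C_1]
    exact one_ne_zero
  have hirr₁ : Irreducible Q₁ := by
    rw [hQ₁]
    exact (irreducible_isUnit_mul hunit).mpr hirr
  have hroot₁ : MvPolynomial.aeval (Fin.cons u ℓ : Fin (r + 1) → MvPolynomial τ k) Q₁ ∈ P := by
    rw [hQ₁, map_mul]
    exact P.mul_mem_left _ hroot
  rw [← hspan]
  exact comap_aeval_cons_eq_span_singleton P ℓ u hind Q₁ hmonic hirr₁ hroot₁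

end Kernel

/-! ## One geometric component: the model is absolutely irreducible -/

section AbsIrreducible

variable {k : Type*} [Field k] {σ : Type*}

/-- **A squarefree element generating an ideal with prime radical is prime** (in any commutative
unique factorisation domain): `(f)` is radical for `f` squarefree
(`Squarefree.isRadical`), so `(f) = √(f)` is prime. -/
theorem prime_of_squarefree_of_isPrime_radical {A : Type*} [CommRing A] [IsDomain A]
    [UniqueFactorizationMonoid A] {f : A}
    (hsq : Squarefree f) (hrad : (Ideal.span {f}).radical.IsPrime) : Prime f := by
  have hf0 : f ≠ 0 := hsq.ne_zero
  have hradical : (Ideal.span {f}).IsRadical := (isRadical_iff_span_singleton).mp hsq.isRadical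
  rw [hradical.radical] at hrad
  exact (Ideal.span_singleton_prime hf0).mp hrad

/-- **`B = 1`: one geometric component forces absolute irreducibility.** Over a PERFECT field `k`,
an irreducible `Q ∈ k[X_σ]` with `geomComponentCount (Q) ≤ 1` stays prime in `k̄[X_σ]`: `Q` is
squarefree over `k̄` (`squarefree_map_of_irreducible`) and the radical of `(Q) k̄[X_σ]` is prime
(`geomComponentCount_eq_one_iff`; the count is positive as `Q` is not a unit). -/
theorem prime_map_of_geomComponentCount_le_one [PerfectField k] [Finite σ] {Q : MvPolynomial σ k}
    (hirr : Irreducible Q) (hcount : geomComponentCount (Ideal.span {Q}) ≤ 1) :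
    Prime (MvPolynomial.map (algebraMap k (AlgebraicClosure k)) Q) := by
  have hne : Ideal.span {Q} ≠ ⊤ := by
    rw [Ne, Ideal.span_singleton_eq_top]
    exact hirr.not_isUnit
  have hpos : 0 < geomComponentCount (Ideal.span {Q}) := geomComponentCount_pos hne
  have hone : geomComponentCount (Ideal.span {Q}) = 1 := le_antisymm hcount hpos
  have hrad := (geomComponentCount_eq_one_iff (Ideal.span {Q})).mp hone
  rw [map_coeff_span_singleton] at hrad
  exact prime_of_squarefree_of_isPrime_radical (squarefree_map_of_irreducible hirr) hrad

/-- The same conclusion spelled as irreducibility over `k̄` (absolute irreducibility of `Q`). -/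
theorem irreducible_map_of_geomComponentCount_le_one [PerfectField k] [Finite σ]
    {Q : MvPolynomial σ k} (hirr : Irreducible Q) (hcount : geomComponentCount (Ideal.span {Q}) ≤ 1) :
    Irreducible (MvPolynomial.map (algebraMap k (AlgebraicClosure k)) Q) :=
  (prime_map_of_geomComponentCount_le_one hirr hcount).irreducible

/-- Route-facing spelling with the literal `ncard` term of `TameResolution` / `TameTransfer`
(`k = ℚ`, perfect): if `Q ∈ ℚ[X]` is irreducible and `(Q) ℚ̄[X]` has at most one minimal prime,
then `Q` is irreducible over `ℚ̄`. -/
theorem irreducible_map_of_ncard_minimalPrimes_le_one {m : ℕ} {Q : MvPolynomial (Fin m) ℚ}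
    (hirr : Irreducible Q)
    (hcount : ((Ideal.map (MvPolynomial.map (algebraMap ℚ (AlgebraicClosure ℚ)))
      (Ideal.span {Q})).minimalPrimes).ncard ≤ 1) :
    Irreducible (MvPolynomial.map (algebraMap ℚ (AlgebraicClosure ℚ)) Q) :=
  irreducible_map_of_geomComponentCount_le_one hirr hcount

end AbsIrreducible

end Summit.ValiantsHypothesis.ValiantsHypothesis.Theorems.LangWeilTransfer

end
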